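/-
Copyright (c) 2026 the pub-hodgecm-mathlib formalisation cell (harness21).  Prover seat hodgecm-mathlib-LH4-p14 (g0), req620 Track A «(D-RAM) FOUR-FRAME» squad
(heir LEAD F0P3a-plan (g19); dealer LH4-plan (g10) WORD #37 (4); TARGET H, self-dealt on LH4-p11 (g0)'s (S)-reduction list, 22:20:55Z).  2026-09-03.
-/
import Summits.HodgeConjecture.HodgeConjecture.Theorems.F0P3cDyRamDiagonalFixedBox    -- ★ p855198 (this seat, TARGET F): `fixed_vertex_box` (the explicit box of a fixed vertex)
import Literature.NumberTheory.Automorphic.UnitaryLatticeTreeIntervalFinite           -- ★ `finite_of_forall_scaleLattice_le_and_le` (lattice intervals are finite); brings `mem_scaleLattice_stdLattice_iff`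
import HarnessLib

/-!
# Crux `H413`, line LH4 «(D-RAM) FOUR-FRAME» road — unit U3_Laws (iii), TIER 2 SUPPORT: «THE FIXED SET IS FINITE» — the vertices of `(K³, diag d)` stable under a REGULAR
# integral diagonal element form a finite set (TARGET H of the (S)-reduction; makes every `Set.ncard` of the four-frame census an honest count)

Cell `hodgecm-mathlib` (D-0151), FLOOR 0, crux item H413 = `stmt-HodgeConjecture-24833`, route of record `HCCMUnconditional`; squad F0∕P3c∕LH4 (req618∕req620).  THEOREMS ONLY
(no `def`, no instance, no notation, no `sorry`, default heartbeats); lane `--supports stmt-HodgeConjecture-24833 --as helper` (count-neutral).  Self-dealt TARGET H on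
LH4-p11 (g0)'s (S)-reduction list (DATUM `F0/P3c/LH4/LH4-p11/g0/DATUM-S-RU-dltT-census.v1.LH4p11g0.md` §5: «every fixed set complete … a tree»), announced 2026-09-03T22:20:55Z.

WHAT IS PROVED (valued field `K` with FINITE residue field, valuation-preserving `σ`, uniformiser `ϖ`, rank 3).  In the unimodular diagonal model `(K³, h_d)`, `|d_i| = 1`
(★ `F0P3cDyRamFixedCountDiagonalModel`): for `T = diag(s)` with `|s_i| ≤ 1` and `s` INJECTIVE (a regular element) the set of vertex lattices `M` of type `t` with
`diag(s)·M ≤ M` is FINITE (`finite_setOf_isVertexLattice_mapGL_diagonal_le`), hence so is the set with `diag(s)·M = M` (`finite_setOf_isVertexLattice_mapGL_diagonal_eq`) — the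
set whose `Set.ncard` is `fixedVertexCount σ ϖ t Γ_b` by ★ p855032 `fixedVertexCount_frameElt_eq_ncard_diagonal_model`.  PROOF: the box ★ p855198 at the three slots gives
`ϖμ_i·e_i ∈ M` and `|μ_i x_i| ≤ 1` on `M`, `μ_i = Π_{j ≠ i} (s_i − s_j) ≠ 0`; with `m = μ₀μ₁μ₂` (`|m| ≤ |μ_i| ≤ 1`) this is the lattice interval `ϖm·𝒪³ ≤ M ≤ m⁻¹·𝒪³`, which is
finite (★ `finite_of_forall_scaleLattice_le_and_le`, [Serre1980Trees, II.1.1]).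
* `v_sub_mul_sub_le_one` — `|(s_i − s_j)(s_i − s_k)| ≤ 1` for integral `s`.
* `scaleLattice_le_of_forall_smul_single_mem` — `(∀ i, c·e_i ∈ M) ⇒ c·𝒪³ ≤ M`.
* `le_scaleLattice_inv_of_forall_v_mul_le_one` — `(∀ x ∈ M, ∀ i, |c·x_i| ≤ 1) ⇒ M ≤ c⁻¹·𝒪³`.
* **`finite_setOf_isVertexLattice_mapGL_diagonal_le`**, **`finite_setOf_isVertexLattice_mapGL_diagonal_eq`** (TARGET H).
HONEST LABEL.  Count-neutral; nothing printed is asserted; the census laws stay PROVER TARGETS; `HC_CM` is proved only modulo the 7 printed citations (2 remaining named inputs: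
hLiu418 = `stmt-HodgeConjecture-24832`, h413 = `stmt-HodgeConjecture-24833`) until rung 0 closes.

## References
* [Serre1980Trees] J.-P. Serre, *Trees*, Springer (1980), Ch. II §1.1 (lattices; finitely many lattices between two given ones).
* [Kottwitz1986BaseChangeUnits] R. E. Kottwitz, *Base change for unit elements of Hecke algebras*, Compositio Math. 60 (1986), §1 pp. 240–241 (the fixed lattices of a regular torus element are finite in number).
* [BruhatTits1972] F. Bruhat, J. Tits, *Groupes réductifs sur un corps local I*, Publ. Math. IHÉS 41 (1972), §10.
-/

set_option autoImplicit false

noncomputable section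

namespace Summit.HodgeConjecture.HodgeConjecture.Cruxes.H413.F0P3cDyRamDiagonalFixedFinite

open Matrix
open Literature.NumberTheory.Automorphic Literature.NumberTheory.Automorphic.HermitianLattice
open Literature.NumberTheory.Automorphic.UnitaryLatticeTree
open Summit.HodgeConjecture.HodgeConjecture.Cruxes.H413.F0P3cDyRamDiagonalFixedBox (fixed_vertex_box)
open scoped Valued WithZero Matrix MatrixGroups

variable {K : Type*} [Field K] [Valued K ℤᵐ⁰] {N : ℕ}

/-- `|(a − b)(a − c)| ≤ 1` for integral `a, b, c`. [cite: Serre1980Trees, II §1.1] -/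
theorem v_sub_mul_sub_le_one {a b c : K} (ha : Valued.v a ≤ 1) (hb : Valued.v b ≤ 1) (hc : Valued.v c ≤ 1) : Valued.v ((a - b) * (a - c)) ≤ 1 := by
  rw [map_mul]
  exact mul_le_one' ((Valuation.map_sub _ a b).trans (max_le ha hb)) ((Valuation.map_sub _ a c).trans (max_le ha hc))

/-- `c·e_i ∈ M` for every `i` ⇒ `c·𝒪^N ≤ M` (`c ≠ 0`). [cite: Serre1980Trees, II §1.1] -/
theorem scaleLattice_le_of_forall_smul_single_mem {c : K} (hc : c ≠ 0) (M : Submodule 𝒪[K] (Fin N → K))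
    (h : ∀ i, c • (Pi.single i 1 : Fin N → K) ∈ M) : scaleLattice c (stdLattice K N) ≤ M := by
  intro x hx
  rw [mem_scaleLattice_stdLattice_iff hc] at hx
  have hvc : 0 < Valued.v c := zero_lt_iff.2 ((Valuation.ne_zero_iff _).2 hc)
  rw [← Finset.univ_sum_single x]
  refine M.sum_mem fun i _ => ?_
  have hq : Valued.v (x i / c) ≤ 1 := by rw [map_div₀, div_le_one₀ hvc]; exact hx i
  have heq : (Pi.single i (x i) : Fin N → K) = (x i / c) • (c • (Pi.single i 1 : Fin N → K)) := by
    rw [smul_smul, div_mul_cancel₀ _ hc, ← Pi.single_smul, smul_eq_mul, mul_one]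
  rw [heq]
  exact M.smul_mem (⟨x i / c, hq⟩ : 𝒪[K]) (h i)

/-- `|c·x_i| ≤ 1` for all `x ∈ M` and all `i` ⇒ `M ≤ c⁻¹·𝒪^N` (`c ≠ 0`). [cite: Serre1980Trees, II §1.1] -/
theorem le_scaleLattice_inv_of_forall_v_mul_le_one {c : K} (hc : c ≠ 0) (M : Submodule 𝒪[K] (Fin N → K))
    (h : ∀ x ∈ M, ∀ i, Valued.v (c * x i) ≤ 1) : M ≤ scaleLattice c⁻¹ (stdLattice K N) := by
  intro x hx
  rw [mem_scaleLattice_stdLattice_iff (inv_ne_zero hc)]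
  intro i
  have hvc : 0 < Valued.v c := zero_lt_iff.2 ((Valuation.ne_zero_iff _).2 hc)
  rw [map_inv₀, ← one_div, le_div_iff₀ hvc, mul_comm, ← map_mul]
  exact h x hx i

/-- **«THE FIXED SET IS FINITE» (TARGET H).**  Finite residue field, `σ` valuation-preserving, `ϖ` a uniformiser, `h_d = diag(d)` unimodular (`|d_i| = 1`), `T = diag(s)` with
`|s_i| ≤ 1` and `s` injective (REGULAR): the vertex lattices of type `t` with `diag(s)·M ≤ M` form a finite set — they all lie in the lattice interval `ϖm·𝒪³ ≤ M ≤ m⁻¹·𝒪³`,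
`m = Π_i Π_{j ≠ i} (s_i − s_j) ≠ 0` (★ p855198 box at each slot), and lattice intervals are finite. [cite: Kottwitz1986BaseChangeUnits, §1 pp. 240–241] [cite: Serre1980Trees, II §1.1]
[cite: BruhatTits1972, §10] -/
theorem finite_setOf_isVertexLattice_mapGL_diagonal_le [Finite 𝓀[K]] {σ : K →+* K} (hvσ : ∀ a, Valued.v (σ a) = Valued.v a) {ϖ : K}
    (hϖ : Valued.v ϖ = WithZero.exp (-1 : ℤ)) {d : Fin 3 → K} (hd : ∀ i, Valued.v (d i) = 1) (s : Fin 3 → K) (hs : ∀ i, Valued.v (s i) ≤ 1)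
    (hinj : Function.Injective s) (T : GL (Fin 3) K) (hT : (T : Matrix (Fin 3) (Fin 3) K) = Matrix.diagonal s) (t : ℕ) :
    {M : Submodule 𝒪[K] (Fin 3 → K) | IsVertexLattice σ ϖ (Matrix.diagonal d) t M ∧ mapGL T M ≤ M}.Finite := by
  have hϖ0 : ϖ ≠ 0 := fun h => by rw [h, map_zero] at hϖ; exact WithZero.zero_ne_coe hϖ
  have hϖ1 : Valued.v ϖ ≤ 1 := by rw [hϖ, ← WithZero.exp_zero]; exact WithZero.exp_le_exp.2 (by norm_num)
  -- the three slot multipliers `μ_i = Π_{j ≠ i} (s_i − s_j)` and their product `m`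
  have h01 : (0 : Fin 3) ≠ 1 := by decide
  have h02 : (0 : Fin 3) ≠ 2 := by decide
  have h12 : (1 : Fin 3) ≠ 2 := by decide
  set μ : Fin 3 → K := ![(s 0 - s 1) * (s 0 - s 2), (s 1 - s 0) * (s 1 - s 2), (s 2 - s 0) * (s 2 - s 1)] with hμdef
  have hμv : ∀ i, Valued.v (μ i) ≤ 1 := by
    intro i; fin_cases i
    · exact v_sub_mul_sub_le_one (hs 0) (hs 1) (hs 2)
    · exact v_sub_mul_sub_le_one (hs 1) (hs 0) (hs 2)
    · exact v_sub_mul_sub_le_one (hs 2) (hs 0) (hs 1)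
  have hsub : ∀ {a b : Fin 3}, a ≠ b → s a - s b ≠ 0 := fun hab h => hab (hinj (sub_eq_zero.1 h))
  have hμ0 : ∀ i, μ i ≠ 0 := by
    intro i; fin_cases i
    · exact mul_ne_zero (hsub h01) (hsub h02)
    · exact mul_ne_zero (hsub h01.symm) (hsub h12)
    · exact mul_ne_zero (hsub h02.symm) (hsub h12.symm)
  set m : K := μ 0 * μ 1 * μ 2 with hm
  have hm0 : m ≠ 0 := mul_ne_zero (mul_ne_zero (hμ0 0) (hμ0 1)) (hμ0 2)
  have hmv : Valued.v m ≤ 1 := by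
    rw [hm, map_mul, map_mul]; exact mul_le_one' (mul_le_one' (hμv 0) (hμv 1)) (hμv 2)
  -- `|m| ≤ |μ_i|`: the other two factors are integral
  have hmle : ∀ i, Valued.v m ≤ Valued.v (μ i) := by
    intro i; fin_cases i
    · show Valued.v m ≤ Valued.v (μ 0)
      rw [hm, mul_assoc, map_mul]; exact mul_le_of_le_one_right' (by rw [map_mul]; exact mul_le_one' (hμv 1) (hμv 2))
    · show Valued.v m ≤ Valued.v (μ 1)
      rw [hm, mul_right_comm, map_mul]; exact mul_le_of_le_one_left' (by rw [map_mul]; exact mul_le_one' (hμv 0) (hμv 2))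
    · show Valued.v m ≤ Valued.v (μ 2)
      rw [hm, map_mul]; exact mul_le_of_le_one_left' (by rw [map_mul]; exact mul_le_one' (hμv 0) (hμv 1))
  -- every fixed vertex lies in the interval `ϖm·𝒪³ ≤ M ≤ m⁻¹·𝒪³`
  refine finite_of_forall_scaleLattice_le_and_le (N := 3) hϖ (a := ϖ * m) (b := m⁻¹) (mul_ne_zero hϖ0 hm0) ?_ ?_
  · rw [map_mul, map_inv₀]
    exact (mul_le_one' hϖ1 hmv).trans ((one_le_inv₀ (zero_lt_iff.2 ((Valuation.ne_zero_iff _).2 hm0))).2 hmv)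
  rintro M ⟨hM, hfix⟩
  -- the box at the three slots
  have hb : ∀ i, (∀ x ∈ M, Valued.v (μ i * x i) ≤ 1) ∧ (ϖ * μ i) • (Pi.single i 1 : Fin 3 → K) ∈ M := by
    intro i; fin_cases i
    · exact fixed_vertex_box hvσ hϖ hd s hs T hT hM hfix h01 h02 h12
    · exact fixed_vertex_box hvσ hϖ hd s hs T hT hM hfix h01.symm h12 h02
    · exact fixed_vertex_box hvσ hϖ hd s hs T hT hM hfix h02.symm h12.symm h01
  constructor
  · -- `ϖm·𝒪³ ≤ M`: `ϖm·e_i = (m ∕ μ_i)·(ϖμ_i·e_i)` with `|m ∕ μ_i| ≤ 1`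
    refine scaleLattice_le_of_forall_smul_single_mem (mul_ne_zero hϖ0 hm0) M fun i => ?_
    have hq : Valued.v (m / μ i) ≤ 1 := by
      rw [map_div₀, div_le_one₀ (zero_lt_iff.2 ((Valuation.ne_zero_iff _).2 (hμ0 i)))]; exact hmle i
    have hcoef : m / μ i * (ϖ * μ i) = ϖ * m := by rw [div_mul_eq_mul_div, div_eq_iff (hμ0 i)]; ring
    have heq : (ϖ * m) • (Pi.single i 1 : Fin 3 → K) = (m / μ i) • ((ϖ * μ i) • (Pi.single i 1 : Fin 3 → K)) := by
      rw [smul_smul, hcoef]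
    rw [heq]
    exact M.smul_mem (⟨m / μ i, hq⟩ : 𝒪[K]) (hb i).2
  · -- `M ≤ m⁻¹·𝒪³`: `|m x_i| ≤ |μ_i x_i| ≤ 1`
    refine le_scaleLattice_inv_of_forall_v_mul_le_one hm0 M fun x hx i => ?_
    rw [map_mul]
    exact (mul_le_mul' (hmle i) le_rfl).trans (by rw [← map_mul]; exact (hb i).1 x hx)

/-- **The `T`-FIXED vertex lattices of type `t` are finitely many** (`diag(s)·M = M`; the subset of TARGET H). [cite: Kottwitz1986BaseChangeUnits, §1 pp. 240–241] [cite: Serre1980Trees, II §1.1] -/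
theorem finite_setOf_isVertexLattice_mapGL_diagonal_eq [Finite 𝓀[K]] {σ : K →+* K} (hvσ : ∀ a, Valued.v (σ a) = Valued.v a) {ϖ : K}
    (hϖ : Valued.v ϖ = WithZero.exp (-1 : ℤ)) {d : Fin 3 → K} (hd : ∀ i, Valued.v (d i) = 1) (s : Fin 3 → K) (hs : ∀ i, Valued.v (s i) ≤ 1)
    (hinj : Function.Injective s) (T : GL (Fin 3) K) (hT : (T : Matrix (Fin 3) (Fin 3) K) = Matrix.diagonal s) (t : ℕ) :
    {M : Submodule 𝒪[K] (Fin 3 → K) | IsVertexLattice σ ϖ (Matrix.diagonal d) t M ∧ mapGL T M = M}.Finite :=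
  (finite_setOf_isVertexLattice_mapGL_diagonal_le hvσ hϖ hd s hs hinj T hT t).subset fun _ hM => ⟨hM.1, hM.2.le⟩

end Summit.HodgeConjecture.HodgeConjecture.Cruxes.H413.F0P3cDyRamDiagonalFixedFinite

end
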